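import Summits.QuantumFields.BalabanUV.T4Continuum.Support.SpreadLift
import Summits.QuantumFields.BalabanUV.T4Continuum.Support.AveragingDeficitBlockDensity
import HarnessLib

/-!
# T⁴ programme, node NE3 — row E-RES♯, sub-row (R♯3b) «DRESSED SLICE LIFT — CURL», file 1: THE FINE CURL OF THE SPREAD LIFT,
# PLAQUETTE BY PLAQUETTE (single-slice plaquettes are `O(a)`; corner plaquettes carry the transplanted coarse curl)

NE3 (node U1b) formalisation swarm `b2b-balaban-t4-ne3-formalise-*`, leaf seat `b2b-balaban-t4-ne3-formalise-leaf-01`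
(gen 4), row **E-RES♯ (R♯3b)** (owner CUT journal l.14429; claim converted from (R♯3a) in FINDING F-ne3leaf01g4-1; SHAPE
`HOME/t4/formal/NE3/Statements/E-RES-R3b-SHAPE-v1.md`).

WHY.  (RES♯) pairs the flux-gradient term of NE3-R2's residual with `√curlSq`; the lift of a coarse direction `φ` that makes this
possible is the DRESSED (spread) lift `ψ = SpreadLiftDirection.spreadLift L V φ` (push defect `O(a)`: `NE3SpreadLiftPushDefect`),
and the one estimate left is ITS FINE CURL against the coarse curl of `φ` at the averaged background.  THIS FILE (0 `def`,
0 `sorry`) does the plaquette-by-plaquette half, at a unitary `V` in `SmallField V a`: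

§1 bookkeeping of the crossing predicate under unit shifts (`isCross_add_e_iff`, `cdiv_add_e_of_not_isCross`,
   `cdiv_add_e_of_isCross`, `crossHol` spelled as a tree holonomy of a `cmod` vector);
§2 **single-slice plaquettes are `O(a)`**: if the plaquette `(x; μ, ν)` meets crossing `μ`-bonds but no crossing `ν`-bond
   (or vice versa), the two dressed values of `ψ` differ by the holonomy of a CLOSED word of length `≤ 3dL` through the tree of the
   entered block, so `‖(d_V ψ)(x; μ, ν)‖ ≤ 18·d²·L²·a·‖φ(c)‖` (`AveragingDeficitBlockDensity.norm_hol_closed_sub_one_le`,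
   `norm_Ad_sub_Ad_le_of_le`); plaquettes meeting no crossing bond have zero curl.
(File 2 `NE3SpreadLiftCurlCorner` treats the corner plaquettes — the transplanted coarse curl — and file 3 `NE3SpreadLiftCurl` the
`ℓ²` assembly over the period torus.)

HONEST FRAMING.  Kinematics of ONE averaging step at ONE background (our frame; [folklore]; context [Balaban1985Averaging]
(47)–(50) p. 25); nothing about Bałaban's minimisers; (RES♯) NOT proved; **NE3 is NOT proved**; spine PROVED 0∕9; finite T⁴ rung
(B)+1 — NOT infinite volume, NOT mass gap, NOT `BetaPertH`, NOT Clay.  PLACEMENT: `Summits/QuantumFields/BalabanUV/`; imports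
`SpreadLift` (p216492) + `AveragingDeficitBlockDensity` (p219502) BY NAME.  HONEST DEPENDENCY (cell page 1): continuum YM on T⁴ ⇐
BetaPertH ∧ nine spine estimates (0/9 proved); BetaPertH ⇐ (D1) ∧ (D4) ∧ CAP+tail; G-an2-4 gates asym, D1 and NE2/3/4.
-/

set_option autoImplicit false

open scoped BigOperators Matrix Matrix.Norms.L2Operator

namespace Summit.QuantumFields.BalabanUV.T4Continuum.NE3SpreadLiftCurlLocal

open Literature.MathematicalPhysics.QuantumFieldTheory.Balaban1983to89
open B7Prop1Explicit B7Prop2Explicit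
open T4AveragingDeficitWall hiding Site Plane Plaq Bond
open T4AveragingDeficitNonAbelian (Ad_mul Ad_sub)
open AveragingDeficitTransport (norm_Ad_of_unitary)
open SkeletonLattice (cdiv cmod smul_cdiv_add_cmod cmod_nonneg cmod_lt cdiv_eq_of_repr cmod_eq_of_repr)
open SpreadLiftWords (IsCross)
open SpreadLiftDirection (spreadLift exitCorner crossHol spreadLift_of_isCross crossSupported_spreadLift)
open AveragingDeficitBlockDensity (norm_hol_closed_sub_one_le norm_Ad_sub_Ad_le_of_le l1_cmod_le)
open AveragingDeficitNearIdentity (Ad_zero)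

noncomputable section

variable {d : ℕ} {n : Type*} [Fintype n] [DecidableEq n]

/-! ## §1 The crossing predicate and the block index under unit shifts -/

omit [Fintype n] [DecidableEq n] in
/-- A transverse unit shift does not change the `μ`-residue: `IsCross L (x + e ν) μ ↔ IsCross L x μ` for `μ ≠ ν`. [folklore] -/
theorem isCross_add_e_iff {L : ℕ} (x : Site d) {μ ν : Fin d} (hμν : μ ≠ ν) : IsCross L (x + e ν) μ ↔ IsCross L x μ := by
  unfold SpreadLiftWords.IsCross SkeletonLattice.cmod
  simp [Pi.add_apply, e_apply, hμν]

omit [Fintype n] [DecidableEq n] in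
/-- Across a NON-crossing `ν`-bond the block index does not change: `cdiv L (x + e ν) = cdiv L x`. [folklore] -/
theorem cdiv_add_e_of_not_isCross {L : ℕ} (hL : 1 ≤ L) {x : Site d} {ν : Fin d} (hν : ¬ IsCross L x ν) :
    cdiv L (x + e ν) = cdiv L x := by
  have hr0 := cmod_nonneg (L := L) hL x
  have hrL := cmod_lt (L := L) hL x
  have hν' : cmod L x ν ≠ (L : ℤ) - 1 := hν
  refine cdiv_eq_of_repr (L := L) (q := cmod L x + e ν) ?_ (fun i => ?_) (fun i => ?_)
  · rw [← add_assoc, smul_cdiv_add_cmod]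
  · have := hr0 i; simp only [Pi.add_apply, e_apply]; split_ifs <;> linarith
  · by_cases hi : i = ν
    · subst hi; have h1 := hrL i; simp only [Pi.add_apply, e_apply, if_true]; omega
    · have h1 := hrL i; simp only [Pi.add_apply, e_apply, if_neg hi]; linarith

omit [Fintype n] [DecidableEq n] in
/-- Across a CROSSING `μ`-bond the block index advances: `cdiv L (x + e μ) = cdiv L x + e μ`. [folklore] -/
theorem cdiv_add_e_of_isCross {L : ℕ} (hL : 1 ≤ L) {x : Site d} {μ : Fin d} (hμ : IsCross L x μ) :
    cdiv L (x + e μ) = cdiv L x + e μ := by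
  have hr0 := cmod_nonneg (L := L) hL x
  have hrL := cmod_lt (L := L) hL x
  have hμ' : cmod L x μ = (L : ℤ) - 1 := hμ
  refine cdiv_eq_of_repr (L := L) (q := cmod L x + e μ - (L : ℤ) • e μ) ?_ (fun i => ?_) (fun i => ?_)
  · have h := smul_cdiv_add_cmod (L := L) x
    rw [smul_add]
    calc x + e μ = ((L : ℤ) • cdiv L x + cmod L x) + e μ := by rw [h]
      _ = _ := by abel
  · by_cases hi : i = μ
    · subst hi; simp only [Pi.add_apply, Pi.sub_apply, Pi.smul_apply, e_apply, if_true, smul_eq_mul, mul_one]; omega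
    · have := hr0 i
      simp only [Pi.add_apply, Pi.sub_apply, Pi.smul_apply, e_apply, if_neg hi, smul_eq_mul, mul_zero]; linarith
  · by_cases hi : i = μ
    · subst hi; simp only [Pi.add_apply, Pi.sub_apply, Pi.smul_apply, e_apply, if_true, smul_eq_mul, mul_one]
      have : (1 : ℤ) ≤ L := by exact_mod_cast hL
      omega
    · have := hrL i
      simp only [Pi.add_apply, Pi.sub_apply, Pi.smul_apply, e_apply, if_neg hi, smul_eq_mul, mul_zero]; linarith

omit [Fintype n] [DecidableEq n] in
/-- The residue vector of the END POINT of a crossing `μ`-bond relative to the entered block's corner: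
`x + e μ − exitCorner L x μ = cmod L (x + e μ)`. [folklore] -/
theorem add_e_sub_exitCorner {L : ℕ} (hL : 1 ≤ L) {x : Site d} {μ : Fin d} (hμ : IsCross L x μ) :
    x + e μ - exitCorner L x μ = cmod L (x + e μ) := by
  unfold SpreadLiftDirection.exitCorner
  rw [← cdiv_add_e_of_isCross hL hμ]
  have h := smul_cdiv_add_cmod (L := L) (x + e μ)
  exact sub_eq_of_eq_add (by rw [add_comm] at h; exact h.symm)

/-- The dressing holonomy of a crossing bond as a tree holonomy of a `cmod` vector. [folklore] -/
theorem crossHol_eq {L : ℕ} (hL : 1 ≤ L) (V : Site d → Fin d → (Matrix n n ℂ)ˣ) {x : Site d} {μ : Fin d}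
    (hμ : IsCross L x μ) : crossHol L V x μ = hol V (exitCorner L x μ) (treeWord (cmod L (x + e μ))) := by
  unfold SpreadLiftDirection.crossHol
  rw [add_e_sub_exitCorner hL hμ]

/-- Holonomies of a unitary configuration are unitary. [folklore] -/
theorem hol_unitary {V : Site d → Fin d → (Matrix n n ℂ)ˣ} (hV : IsUnitaryCfg V) (x : Site d) (w : List (Letter d)) :
    hol V x w ∈ unitaryUnits (Matrix n n ℂ) := hol_mem_of hV x w

/-! ## §2 Single-slice plaquettes: the fine curl of the spread lift is `O(a)` -/

omit [Fintype n] [DecidableEq n] in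
/-- The length budget of the single-slice discrepancy loops: `l1 (cmod L p) + 1 + l1 (cmod L p′) ≤ 3dL` (`d, L ≥ 1`). [folklore] -/
theorem loopLen_le {L : ℕ} (hL : 1 ≤ L) (hd : 1 ≤ d) (p p' : Site d) :
    ((l1 (cmod L p) + 1 + l1 (cmod L p') : ℕ) : ℝ) ≤ 3 * d * L := by
  have h1 := l1_cmod_le (d := d) hL p
  have h2 := l1_cmod_le (d := d) hL p'
  have h3 : 1 ≤ d * L := Nat.one_le_iff_ne_zero.mpr (Nat.mul_ne_zero (by omega) (by omega))
  have : l1 (cmod L p) + 1 + l1 (cmod L p') ≤ 3 * (d * L) := by omega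
  calc ((l1 (cmod L p) + 1 + l1 (cmod L p') : ℕ) : ℝ) ≤ ((3 * (d * L) : ℕ) : ℝ) := by exact_mod_cast this
    _ = 3 * d * L := by push_cast; ring

/-- **A `μ`-CROSSING, NON-`ν`-CROSSING PLAQUETTE.**  For `L ≥ 1`, `d ≥ 1`, unitary `V` in `SmallField V a` (`a ≥ 0`) and a plaquette
`(x; μ, ν)`, `μ ≠ ν`, whose `μ`-bonds cross (`IsCross L x μ`) and whose `ν`-bonds do not (`¬IsCross L x ν`):
`‖(d_V (spreadLift L V φ))(x; μ, ν)‖ ≤ 2·(3dL)²·a·‖φ (cdiv L x) μ‖` — the two dressed copies of `φ(c)` differ by the holonomy of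
the closed word `treeWord r₂ ++ [ν⁻] ++ rev (treeWord r₁)` from the entered block's corner. [folklore] -/
theorem norm_curlAt_spreadLift_le_of_cross_left [Nonempty n] {L : ℕ} (hL : 1 ≤ L) (hd : 1 ≤ d)
    {V : Site d → Fin d → (Matrix n n ℂ)ˣ} (hV : IsUnitaryCfg V) {a : ℝ} (ha : 0 ≤ a) (hVa : SmallField V a)
    (φ : Site d → Fin d → Matrix n n ℂ) {x : Site d} {μ ν : Fin d} (hμν : μ ≠ ν) (hμ : IsCross L x μ)
    (hν : ¬ IsCross L x ν) :
    ‖curlAt V (spreadLift L V φ) x μ ν‖ ≤ 2 * ((3 * d * L) ^ 2 * a) * ‖φ (cdiv L x) μ‖ := by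
  -- the four bond values
  have hμ' : IsCross L (x + e ν) μ := (isCross_add_e_iff x hμν).mpr hμ
  have hν' : ¬ IsCross L (x + e μ) ν := fun h => hν ((isCross_add_e_iff x (Ne.symm hμν)).mp h)
  have hc : cdiv L (x + e ν) = cdiv L x := cdiv_add_e_of_not_isCross hL hν
  have hq : exitCorner L (x + e ν) μ = exitCorner L x μ := by
    unfold SpreadLiftDirection.exitCorner; rw [hc]
  set q : Site d := exitCorner L x μ with hqdef
  set r₁ : Site d := cmod L (x + e μ) with hr₁
  set r₂ : Site d := cmod L (x + e ν + e μ) with hr₂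
  set T₁ : (Matrix n n ℂ)ˣ := hol V q (treeWord r₁) with hT₁
  set T₂ : (Matrix n n ℂ)ˣ := hol V q (treeWord r₂) with hT₂
  have hψ1 : spreadLift L V φ x μ = Ad T₁⁻¹ (φ (cdiv L x) μ) := by
    rw [spreadLift_of_isCross L V φ hμ, crossHol_eq hL V hμ]
  have hψ2 : spreadLift L V φ (x + e ν) μ = Ad T₂⁻¹ (φ (cdiv L x) μ) := by
    rw [spreadLift_of_isCross L V φ hμ', crossHol_eq hL V hμ', hq, hc]
  have hψ3 : spreadLift L V φ x ν = 0 := crossSupported_spreadLift L V φ x ν hν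
  have hψ4 : spreadLift L V φ (x + e μ) ν = 0 := crossSupported_spreadLift L V φ (x + e μ) ν hν'
  -- unitarity
  have hT₁u : T₁ ∈ unitaryUnits (Matrix n n ℂ) := hol_unitary hV _ _
  have hT₂u : T₂ ∈ unitaryUnits (Matrix n n ℂ) := hol_unitary hV _ _
  have hVu : V (x + e μ) ν ∈ unitaryUnits (Matrix n n ℂ) := hV _ _
  have hA : T₁⁻¹ ∈ unitaryUnits (Matrix n n ℂ) := (unitaryUnits _).inv_mem hT₁u
  have hB : V (x + e μ) ν * T₂⁻¹ ∈ unitaryUnits (Matrix n n ℂ) :=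
    (unitaryUnits _).mul_mem hVu ((unitaryUnits _).inv_mem hT₂u)
  -- the curl in closed form
  have hcurl : curlAt V (spreadLift L V φ) x μ ν
      = Ad (V x μ) (Ad T₁⁻¹ (φ (cdiv L x) μ) - Ad (V (x + e μ) ν * T₂⁻¹) (φ (cdiv L x) μ)) := by
    simp only [curlAt, hψ1, hψ2, hψ3, hψ4, Ad_zero, Ad_sub, Ad_mul, add_zero, sub_zero]
  -- the two corners coincide: `q = L•cdiv(x+e_μ) = L•cdiv(x+e_ν+e_μ)`
  have hq1 : q = (L : ℤ) • cdiv L (x + e μ) := by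
    rw [hqdef]; unfold SpreadLiftDirection.exitCorner; rw [cdiv_add_e_of_isCross hL hμ]
  have hq2 : q = (L : ℤ) • cdiv L (x + e ν + e μ) := by
    rw [hqdef]; unfold SpreadLiftDirection.exitCorner; rw [cdiv_add_e_of_isCross hL hμ', hc]
  have hp : q + disp (treeWord r₂) = x + e ν + e μ := by
    rw [disp_treeWord, hq2, hr₂, smul_cdiv_add_cmod]
  have hp3 : x + e μ = q + disp (treeWord r₁) := by
    rw [disp_treeWord, hq1, hr₁, smul_cdiv_add_cmod]
  have hr₂' : r₂ = r₁ + e ν := by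
    have key := smul_cdiv_add_cmod (L := L) (x + e μ + e ν)
    have key0 := smul_cdiv_add_cmod (L := L) (x + e μ)
    rw [cdiv_add_e_of_not_isCross hL hν'] at key
    have e1 : cmod L (x + e μ + e ν) = x + e μ + e ν - (L : ℤ) • cdiv L (x + e μ) := eq_sub_of_add_eq' key
    have e0 : cmod L (x + e μ) = x + e μ - (L : ℤ) • cdiv L (x + e μ) := eq_sub_of_add_eq' key0
    rw [hr₂, hr₁, show x + e ν + e μ = x + e μ + e ν by abel, e1, e0]; abel
  -- the discrepancy is a closed word through the entered block's tree
  set w : List (Letter d) := treeWord r₂ ++ ((ν, false) :: revWord (treeWord r₁)) with hw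
  have hclosed : disp w = 0 := by
    simp only [hw, disp_append, disp_treeWord, disp_cons, disp_revWord, Letter.vec_false, hr₂']
    abel
  have hhol : hol V q w = T₂ * ((V (x + e μ) ν)⁻¹ * T₁⁻¹) := by
    rw [hw, hol_append, ← hT₂, hp, hol_cons, stepHol_false, Letter.vec_false,
      show x + e ν + e μ + -e ν = x + e μ by abel, show x + e ν + e μ - e ν = x + e μ by abel,
      hol_revWord' V (x + e μ) (treeWord r₁) hp3, ← hT₁]
  have hloop : ‖(((V (x + e μ) ν * T₂⁻¹)⁻¹ * T₁⁻¹ : (Matrix n n ℂ)ˣ) : Matrix n n ℂ) - 1‖ ≤ (3 * d * L) ^ 2 * a := by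
    have hprod : (V (x + e μ) ν * T₂⁻¹)⁻¹ * T₁⁻¹ = hol V q w := by rw [hhol, mul_inv_rev, inv_inv, mul_assoc]
    rw [hprod]
    refine (norm_hol_closed_sub_one_le hV ha hVa q w hclosed).trans ?_
    have hlen : ((w.length : ℕ) : ℝ) ≤ 3 * d * L := by
      have : w.length = l1 (cmod L (x + e ν + e μ)) + 1 + l1 (cmod L (x + e μ)) := by
        simp only [hw, List.length_append, length_treeWord, List.length_cons, length_revWord, hr₁, hr₂]
        ring
      rw [this]; exact loopLen_le hL hd _ _
    exact mul_le_mul_of_nonneg_right (pow_le_pow_left₀ (Nat.cast_nonneg _) hlen 2) ha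
  -- assemble
  rw [hcurl, norm_Ad_of_unitary (hV x μ)]
  exact norm_Ad_sub_Ad_le_of_le hA hB _ hloop

/-- **A `ν`-CROSSING, NON-`μ`-CROSSING PLAQUETTE** (the mirror case).  For `L ≥ 1`, `d ≥ 1`, unitary `V` in `SmallField V a`
(`a ≥ 0`) and a plaquette `(x; μ, ν)`, `μ ≠ ν`, whose `ν`-bonds cross and whose `μ`-bonds do not:
`‖(d_V (spreadLift L V φ))(x; μ, ν)‖ ≤ 2·(3dL)²·a·‖φ (cdiv L x) ν‖` — the closed word is `treeWord r₄ ++ [μ⁺] ++ rev (treeWord r₃)`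
from the corner of the block entered by the `ν`-bonds. [folklore] -/
theorem norm_curlAt_spreadLift_le_of_cross_right [Nonempty n] {L : ℕ} (hL : 1 ≤ L) (hd : 1 ≤ d)
    {V : Site d → Fin d → (Matrix n n ℂ)ˣ} (hV : IsUnitaryCfg V) {a : ℝ} (ha : 0 ≤ a) (hVa : SmallField V a)
    (φ : Site d → Fin d → Matrix n n ℂ) {x : Site d} {μ ν : Fin d} (hμν : μ ≠ ν) (hμ : ¬ IsCross L x μ)
    (hν : IsCross L x ν) :
    ‖curlAt V (spreadLift L V φ) x μ ν‖ ≤ 2 * ((3 * d * L) ^ 2 * a) * ‖φ (cdiv L x) ν‖ := by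
  -- the four bond values
  have hν' : IsCross L (x + e μ) ν := (isCross_add_e_iff x (Ne.symm hμν)).mpr hν
  have hμ' : ¬ IsCross L (x + e ν) μ := fun h => hμ ((isCross_add_e_iff x hμν).mp h)
  have hc : cdiv L (x + e μ) = cdiv L x := cdiv_add_e_of_not_isCross hL hμ
  have hq : exitCorner L (x + e μ) ν = exitCorner L x ν := by
    unfold SpreadLiftDirection.exitCorner; rw [hc]
  set q : Site d := exitCorner L x ν with hqdef
  set r₃ : Site d := cmod L (x + e μ + e ν) with hr₃
  set r₄ : Site d := cmod L (x + e ν) with hr₄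
  set T₃ : (Matrix n n ℂ)ˣ := hol V q (treeWord r₃) with hT₃
  set T₄ : (Matrix n n ℂ)ˣ := hol V q (treeWord r₄) with hT₄
  have hψ1 : spreadLift L V φ x μ = 0 := crossSupported_spreadLift L V φ x μ hμ
  have hψ2 : spreadLift L V φ (x + e μ) ν = Ad T₃⁻¹ (φ (cdiv L x) ν) := by
    rw [spreadLift_of_isCross L V φ hν', crossHol_eq hL V hν', hq, hc]
  have hψ3 : spreadLift L V φ (x + e ν) μ = 0 := crossSupported_spreadLift L V φ (x + e ν) μ hμ'
  have hψ4 : spreadLift L V φ x ν = Ad T₄⁻¹ (φ (cdiv L x) ν) := by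
    rw [spreadLift_of_isCross L V φ hν, crossHol_eq hL V hν]
  -- unitarity
  have hT₃u : T₃ ∈ unitaryUnits (Matrix n n ℂ) := hol_unitary hV _ _
  have hT₄u : T₄ ∈ unitaryUnits (Matrix n n ℂ) := hol_unitary hV _ _
  have hVu : (V (x + e ν) μ)⁻¹ ∈ unitaryUnits (Matrix n n ℂ) := (unitaryUnits _).inv_mem (hV _ _)
  have hA : T₃⁻¹ ∈ unitaryUnits (Matrix n n ℂ) := (unitaryUnits _).inv_mem hT₃u
  have hB : (V (x + e ν) μ)⁻¹ * T₄⁻¹ ∈ unitaryUnits (Matrix n n ℂ) :=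
    (unitaryUnits _).mul_mem hVu ((unitaryUnits _).inv_mem hT₄u)
  have hVV : V x μ * V (x + e μ) ν ∈ unitaryUnits (Matrix n n ℂ) := (unitaryUnits _).mul_mem (hV _ _) (hV _ _)
  -- the curl in closed form
  have hcurl : curlAt V (spreadLift L V φ) x μ ν
      = Ad (V x μ * V (x + e μ) ν) (Ad T₃⁻¹ (φ (cdiv L x) ν) - Ad ((V (x + e ν) μ)⁻¹ * T₄⁻¹) (φ (cdiv L x) ν)) := by
    simp only [curlAt, hψ1, hψ2, hψ3, hψ4, Ad_zero, Ad_sub, Ad_mul, zero_add, sub_zero]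
  -- the corner: `q = L•cdiv(x+e_ν) = L•cdiv(x+e_μ+e_ν)`
  have hq1 : q = (L : ℤ) • cdiv L (x + e ν) := by
    rw [hqdef]; unfold SpreadLiftDirection.exitCorner; rw [cdiv_add_e_of_isCross hL hν]
  have hq2 : q = (L : ℤ) • cdiv L (x + e μ + e ν) := by
    rw [hqdef]; unfold SpreadLiftDirection.exitCorner; rw [cdiv_add_e_of_isCross hL hν', hc]
  have hp : q + disp (treeWord r₄) = x + e ν := by
    rw [disp_treeWord, hq1, hr₄, smul_cdiv_add_cmod]
  have hp3 : x + e μ + e ν = q + disp (treeWord r₃) := by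
    rw [disp_treeWord, hq2, hr₃, smul_cdiv_add_cmod]
  have hr₃' : r₃ = r₄ + e μ := by
    have key := smul_cdiv_add_cmod (L := L) (x + e ν + e μ)
    have key0 := smul_cdiv_add_cmod (L := L) (x + e ν)
    rw [cdiv_add_e_of_not_isCross hL hμ'] at key
    have e1 : cmod L (x + e ν + e μ) = x + e ν + e μ - (L : ℤ) • cdiv L (x + e ν) := eq_sub_of_add_eq' key
    have e0 : cmod L (x + e ν) = x + e ν - (L : ℤ) • cdiv L (x + e ν) := eq_sub_of_add_eq' key0
    rw [hr₃, hr₄, show x + e μ + e ν = x + e ν + e μ by abel, e1, e0]; abel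
  -- the discrepancy is a closed word through the entered block's tree
  set w : List (Letter d) := treeWord r₄ ++ ((μ, true) :: revWord (treeWord r₃)) with hw
  have hclosed : disp w = 0 := by
    simp only [hw, disp_append, disp_treeWord, disp_cons, disp_revWord, Letter.vec_true, hr₃']
    abel
  have hhol : hol V q w = T₄ * (V (x + e ν) μ * T₃⁻¹) := by
    rw [hw, hol_append, ← hT₄, hp, hol_cons, stepHol_true, Letter.vec_true,
      show x + e ν + e μ = x + e μ + e ν by abel, hol_revWord' V (x + e μ + e ν) (treeWord r₃) hp3, ← hT₃]
  have hloop : ‖((((V (x + e ν) μ)⁻¹ * T₄⁻¹)⁻¹ * T₃⁻¹ : (Matrix n n ℂ)ˣ) : Matrix n n ℂ) - 1‖ ≤ (3 * d * L) ^ 2 * a := by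
    have hprod : ((V (x + e ν) μ)⁻¹ * T₄⁻¹)⁻¹ * T₃⁻¹ = hol V q w := by rw [hhol, mul_inv_rev, inv_inv, inv_inv, mul_assoc]
    rw [hprod]
    refine (norm_hol_closed_sub_one_le hV ha hVa q w hclosed).trans ?_
    have hlen : ((w.length : ℕ) : ℝ) ≤ 3 * d * L := by
      have : w.length = l1 (cmod L (x + e ν)) + 1 + l1 (cmod L (x + e μ + e ν)) := by
        simp only [hw, List.length_append, length_treeWord, List.length_cons, length_revWord, hr₃, hr₄]
        ring
      rw [this]; exact loopLen_le hL hd _ _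
    exact mul_le_mul_of_nonneg_right (pow_le_pow_left₀ (Nat.cast_nonneg _) hlen 2) ha
  -- assemble
  rw [hcurl, norm_Ad_of_unitary hVV]
  exact norm_Ad_sub_Ad_le_of_le hA hB _ hloop

/-- **A PLAQUETTE MEETING NO CROSSING BOND HAS ZERO CURL**: if neither the `μ`-bonds nor the `ν`-bonds of `(x; μ, ν)` cross
(`μ ≠ ν`), all four bond values of `spreadLift L V φ` vanish. [folklore] -/
theorem curlAt_spreadLift_eq_zero {L : ℕ} (V : Site d → Fin d → (Matrix n n ℂ)ˣ) (φ : Site d → Fin d → Matrix n n ℂ)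
    {x : Site d} {μ ν : Fin d} (hμν : μ ≠ ν) (hμ : ¬ IsCross L x μ) (hν : ¬ IsCross L x ν) :
    curlAt V (spreadLift L V φ) x μ ν = 0 := by
  have hν' : ¬ IsCross L (x + e μ) ν := fun h => hν ((isCross_add_e_iff x (Ne.symm hμν)).mp h)
  have hμ' : ¬ IsCross L (x + e ν) μ := fun h => hμ ((isCross_add_e_iff x hμν).mp h)
  simp only [curlAt, crossSupported_spreadLift L V φ x μ hμ, crossSupported_spreadLift L V φ (x + e μ) ν hν',
    crossSupported_spreadLift L V φ (x + e ν) μ hμ', crossSupported_spreadLift L V φ x ν hν, Ad_zero, add_zero, sub_zero]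

/-- **THE SINGLE-SLICE BOUND, BOTH CASES AT ONCE**: whenever NOT both bond directions of `(x; μ, ν)` cross,
`‖(d_V (spreadLift L V φ))(x; μ, ν)‖ ≤ 2·(3dL)²·a·(‖φ (cdiv L x) μ‖ + ‖φ (cdiv L x) ν‖)`. [folklore] -/
theorem norm_curlAt_spreadLift_le_of_not_corner [Nonempty n] {L : ℕ} (hL : 1 ≤ L) (hd : 1 ≤ d)
    {V : Site d → Fin d → (Matrix n n ℂ)ˣ} (hV : IsUnitaryCfg V) {a : ℝ} (ha : 0 ≤ a) (hVa : SmallField V a)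
    (φ : Site d → Fin d → Matrix n n ℂ) {x : Site d} {μ ν : Fin d} (hμν : μ ≠ ν) (h : ¬ (IsCross L x μ ∧ IsCross L x ν)) :
    ‖curlAt V (spreadLift L V φ) x μ ν‖ ≤ 2 * ((3 * d * L) ^ 2 * a) * (‖φ (cdiv L x) μ‖ + ‖φ (cdiv L x) ν‖) := by
  have hK : 0 ≤ 2 * ((3 * (d : ℝ) * L) ^ 2 * a) := by positivity
  by_cases hμ : IsCross L x μ
  · have hν : ¬ IsCross L x ν := fun hν => h ⟨hμ, hν⟩
    calc ‖curlAt V (spreadLift L V φ) x μ ν‖ ≤ 2 * ((3 * d * L) ^ 2 * a) * ‖φ (cdiv L x) μ‖ :=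
          norm_curlAt_spreadLift_le_of_cross_left hL hd hV ha hVa φ hμν hμ hν
      _ ≤ _ := by
          refine mul_le_mul_of_nonneg_left ?_ hK
          linarith [norm_nonneg (φ (cdiv L x) ν)]
  · by_cases hν : IsCross L x ν
    · calc ‖curlAt V (spreadLift L V φ) x μ ν‖ ≤ 2 * ((3 * d * L) ^ 2 * a) * ‖φ (cdiv L x) ν‖ :=
            norm_curlAt_spreadLift_le_of_cross_right hL hd hV ha hVa φ hμν hμ hν
        _ ≤ _ := by
            refine mul_le_mul_of_nonneg_left ?_ hK
            linarith [norm_nonneg (φ (cdiv L x) μ)]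
    · rw [curlAt_spreadLift_eq_zero V φ hμν hμ hν, norm_zero]
      positivity

end

end Summit.QuantumFields.BalabanUV.T4Continuum.NE3SpreadLiftCurlLocal
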